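import Mathlib
import Literature.Probability.PointProcesses.LensConsistentLaw
import Summits.AtomisticToContinuum.Crystallization.Theorems.FrustrationRangeCertificatesPatternPricedCertificatesStubFarField
import HarnessLib

/-!
# Crux `PatternPricedCertificates` (stmt-AtomisticToContinuum-12974), line `registered` — stub `stub_patternFarField`

This file discharges the registered stub `stub_patternFarField` of line `registered` for crux
stmt-AtomisticToContinuum-12974
(`Summit.AtomisticToContinuum.Crystallization.Theses.FrustrationRangeCertificates.PatternPricedCertificates`).

**Statement (far field at pattern level).** For every separation `δ > 0` and every `η > 0` there is
`ρ₀` such that for all `ρ ≥ ρ₀`, every level `L` and every `(δ, L)`-admissible rooted pattern `S`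
(`IsRootedPattern δ L S`: all norms in `[δ, L]`, all mutual distances `≥ δ`), the Lennard-Jones
energy of the root with the points of `S` beyond distance `ρ` is `≥ -η`:
`-η ≤ ∑_{v ∈ S, ¬ ‖v‖ ≤ ρ} V_LJ(‖v‖)`, uniformly in `L` and `S`.

**Proof.** Embed the pattern as a finite configuration with the root first:
`x : Fin (#S + 1) → ℝ³`, `x 0 = 0`, `x (k+1) = e k` for an enumeration `e : Fin #S ≃ S`.  The
configuration is `δ`-separated (`dist 0 v = ‖v‖ ≥ δ`, `dist v w = ‖v - w‖ ≥ δ` for `v ≠ w`), so the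
landed configuration-level far-field bound `stub_farField` at the particle `0` and range `ρ ≥ ρ₀ := L₀`
gives `-η ≤ ∑_{j ≠ 0, ¬ dist (x 0) (x j) ≤ ρ} V_LJ(dist (x 0) (x j))`, and this sum is the pattern sum
after reindexing along `j ↦ x j` (`Finset.sum_bij`).

No new definitions; nothing is assumed. [folklore]
-/

noncomputable section

open scoped BigOperators Classical

namespace Summit.AtomisticToContinuum.Crystallization.Theorems.PatternPricedCertificates

open Literature.Probability.PointProcesses (IsRootedPattern)
open Literature.MathematicalPhysics.StatisticalMechanics (lennardJones)

/-- **Far field at pattern level (stub `stub_patternFarField`).** For every separation `δ > 0` and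
`η > 0` there is `ρ₀` such that for all `ρ ≥ ρ₀`, all `L` and every `(δ, L)`-admissible rooted
pattern `S`, `-η ≤ ∑_{v ∈ S, ‖v‖ > ρ} V_LJ(‖v‖)`: embed `S ∪ {0}` as a `δ`-separated configuration
`Fin (#S + 1) → ℝ³` with the root at index `0` and apply the configuration-level bound
`stub_farField` at the root, reindexing the sum along `j ↦ x j`. [folklore] -/
theorem stub_patternFarField :
    ∀ δ : ℝ, 0 < δ → ∀ η : ℝ, 0 < η → ∃ ρ₀ : ℝ, ∀ ρ L : ℝ, ρ₀ ≤ ρ →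
      ∀ S : Finset (EuclideanSpace ℝ (Fin 3)), Literature.Probability.PointProcesses.IsRootedPattern δ L S →
        -η ≤ ∑ v ∈ S.filter (fun v => ¬ ‖v‖ ≤ ρ), Literature.MathematicalPhysics.StatisticalMechanics.lennardJones ‖v‖ := by
  intro δ hδ η hη
  obtain ⟨L₀, hL₀⟩ := stub_farField δ hδ η hη
  refine ⟨L₀, fun ρ L hρ S hS => ?_⟩
  -- enumerate `S` and put the root first
  set n : ℕ := S.card
  set e : Fin n ≃ ↥S := S.equivFin.symm
  set x : Fin (n + 1) → EuclideanSpace ℝ (Fin 3) :=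
    Fin.cons (0 : EuclideanSpace ℝ (Fin 3)) (fun k => ((e k : ↥S) : EuclideanSpace ℝ (Fin 3)))
  have hx0 : x 0 = 0 := Fin.cons_zero _ _
  have hxs : ∀ k : Fin n, x k.succ = ((e k : ↥S) : EuclideanSpace ℝ (Fin 3)) := fun k =>
    Fin.cons_succ _ _ _
  have hxmem : ∀ k : Fin n, x k.succ ∈ S := fun k => by
    rw [hxs]
    exact (e k).2
  have hxinj : ∀ k l : Fin n, x k.succ = x l.succ → k = l := fun k l h => by
    rw [hxs, hxs] at h
    exact e.injective (Subtype.ext h)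
  -- `δ`-separation of the embedded configuration
  have hsep : ∀ i j : Fin (n + 1), i ≠ j → δ ≤ dist (x i) (x j) := by
    intro i j hij
    rcases i.eq_zero_or_eq_succ with rfl | ⟨k, rfl⟩ <;>
      rcases j.eq_zero_or_eq_succ with rfl | ⟨l, rfl⟩
    · exact absurd rfl hij
    · rw [hx0, dist_zero_left]
      exact (hS.1 _ (hxmem l)).1
    · rw [hx0, dist_zero_right]
      exact (hS.1 _ (hxmem k)).1
    · rw [dist_eq_norm]
      exact hS.2 _ (hxmem k) _ (hxmem l) fun h => hij (by rw [hxinj k l h])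
  -- the configuration-level far-field bound at the root
  have key := hL₀ ρ hρ (n + 1) x hsep 0
  -- identify the two sums along `j ↦ x j`
  have hsum : ∑ j ∈ (Finset.univ.erase (0 : Fin (n + 1))).filter (fun j => ¬ dist (x 0) (x j) ≤ ρ),
      lennardJones (dist (x 0) (x j)) = ∑ v ∈ S.filter (fun v => ¬ ‖v‖ ≤ ρ), lennardJones ‖v‖ := by
    refine Finset.sum_bij (fun j _ => x j) ?_ ?_ ?_ ?_
    · intro j hj
      simp only [Finset.mem_filter, Finset.mem_erase, Finset.mem_univ, and_true] at hj
      obtain ⟨k, rfl⟩ := Fin.exists_succ_eq.2 hj.1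
      rw [Finset.mem_filter]
      refine ⟨hxmem k, ?_⟩
      rw [hx0, dist_zero_left] at hj
      exact hj.2
    · intro i hi j hj h
      simp only [Finset.mem_filter, Finset.mem_erase, Finset.mem_univ, and_true] at hi hj
      obtain ⟨k, rfl⟩ := Fin.exists_succ_eq.2 hi.1
      obtain ⟨l, rfl⟩ := Fin.exists_succ_eq.2 hj.1
      rw [hxinj k l h]
    · intro v hv
      rw [Finset.mem_filter] at hv
      refine ⟨(e.symm ⟨v, hv.1⟩).succ, ?_, ?_⟩
      · simp only [Finset.mem_filter, Finset.mem_erase, Finset.mem_univ, and_true]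
        refine ⟨Fin.succ_ne_zero _, ?_⟩
        rw [hx0, dist_zero_left, hxs, Equiv.apply_symm_apply]
        exact hv.2
      · rw [hxs, Equiv.apply_symm_apply]
    · intro j _
      rw [hx0, dist_zero_left]
  rw [← hsum]
  exact key

end Summit.AtomisticToContinuum.Crystallization.Theorems.PatternPricedCertificates

end
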